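import Summits.NavierStokesRegularity.NavierStokesRegularity.Theorems.TypeIQuantSubcubicExp.Negative.ThinCascadeLiouvilleImpliesFDL
import Summits.NavierStokesRegularity.NavierStokesRegularity.Theorems.LerayQuarterDissipationFiniteDissipationLiouvilleEnvelopeIff
import Summits.NavierStokesRegularity.NavierStokesRegularity.Theorems.AsymmetricFlickerLiouville.Negative.AsTypedIsFDL
import HarnessLib

/-!
# The envelope split of S3 (`stub_thinCascadeLiouville`) — refuter side, negative lane

Crux `stmt-NavierStokesRegularity-24077` (`QuarterLogPincer.TypeIQuantSubcubicExp`), line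
`Cruxes/TypeIQuantSubcubicExp/Lines/thin_cascade.lean`, stub S3
`stub_thinCascadeLiouville : ∀ M q v g, ¬ ThinObject M q v g`; and crux
`stmt-NavierStokesRegularity-24453` (`CalmSliceGate.AsymmetricFlickerLiouville`).

Nothing here asserts S3, 24077, 24453, 24374 or 22144: every statement is an implication or an
equivalence between OPEN statements (pure logic over landed theorems). No summit statement and no
crux is proved by this file.

## Findings (kernel-checked below)

Split the thin objects `ThinObject M q v g` by whether the field `v` carries a space–time Type-I
ENVELOPE `HasTypeIDecay A v` (`‖v(t,x)‖ ≤ A/(‖x‖+√(−t))`) for some `A`: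

1. `not_finiteDissipationLiouville_of_thinObject_of_hasTypeIDecay` — an ENVELOPED thin object
   refutes `FiniteDissipationLiouville` (22144): the envelope alone puts `v` in a finite-dissipation
   stratum (`Hardness.exists_dissipationLaw_of_hasTypeIDecay`), and `SingularAt v 0` is the crux's
   singular clause. The log-thin trace budget, the uniform local energy and the weak trace of the
   thin object are NOT used.
2. `envelopedThinLiouville_iff_finiteDissipationLiouville` — "no enveloped thin object" is
   EQUIVALENT to 22144 (backward: a singular member of `𝒟_{C,K}` yields the enveloped thin critical
   element of `exists_thinObject_of_singular_member`, budget `q = 3|B₁|A³`).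
3. `envelopedThinLiouville_iff_asymmetricFlickerLiouville` /
   `envelopedThinLiouville_iff_perpetualFlickerLiouville` /
   `envelopedThinLiouville_iff_envelopeLiouville` — hence equivalent to 24453, to 24374 and to the
   envelope-class Liouville statement (all four typed walls coincide on the enveloped half).
4. `thinCascadeLiouville_iff_finiteDissipationLiouville_and_residue` (and the `asymmetricFlicker`
   form) — S3 is EXACTLY `22144 ∧ R` (`= 24453 ∧ R`), where the residue
   `R := ∀ M q v g, ThinObject M q v g → (∀ A, ¬ HasTypeIDecay A v) → False` says "no NON-enveloped
   thin object".

Reading for the lead / planners (refuter census, numbers not adjectives): on the enveloped half the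
budget clause `∫_{1<|x|<R} |g|³ ≤ q(1+log R)` buys nothing — every enveloped singular object meets it
with `q = 3|B₁|A³` — so S3 is not thinner than the CalmSliceGate / LerayQuarterDissipation wall; it is
that wall plus the non-enveloped residue `R`, and the budget only thins `R`. Every backward-DSS /
rotated-DSS Type-I candidate profile is enveloped (`IsTypeIDSSProfile` carries `HasTypeIDecay`), so an
instrument row on such a candidate kills 22144, 24453, 24374 and S3 at once
(`Hardness.not_finiteDissipationLiouville_of_isTypeIDSSProfile`,
`not_thinCascadeLiouville_of_isTypeIDSSProfile`) and can never separate S3 from 24453; only a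
NON-enveloped singular Type-I ancient mild object with uniform local energy and a log-thin trace
could. Whether every thin object already carries an enveloped critical element (which would give
`S3 ⟺ 22144`) is left open here.
-/

-- the summit and its single sub-problem share the name (CONVENTIONS §1), as in every Theorems file
set_option linter.dupNamespace false

namespace Summit.NavierStokesRegularity.NavierStokesRegularity.Theorems.TypeIQuantSubcubicExp.Negative

open MeasureTheory Set Filter Topology Metric Function
open Literature.Analysis Literature.Analysis.FluidPDE
open Summit.NavierStokesRegularity.NavierStokesRegularity.Theorems
open Summit.NavierStokesRegularity.NavierStokesRegularity.Theorems.FiniteDissipationLiouville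
open Summit.NavierStokesRegularity.NavierStokesRegularity.Cruxes.TypeIQuantSubcubicExp.ThinCascade
  (ThinObject SingularAt)
open scoped ENNReal NNReal

/-! ### 1. Enveloped thin objects sit on the `FiniteDissipationLiouville` wall -/

/-- **An enveloped thin object refutes `FiniteDissipationLiouville`.** Only the gauge clause
`IsTypeIAncientMild M v`, the singular clause `SingularAt v 0` and the envelope are used: the
envelope supplies a dissipation law `∫ |∇v(s)|² ≤ K'/√(−s)`
(`Hardness.exists_dissipationLaw_of_hasTypeIDecay`). [folklore] -/
theorem not_finiteDissipationLiouville_of_thinObject_of_hasTypeIDecay {M q A : ℝ}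
    {v : ℝ → EuclideanSpace ℝ (Fin 3) → EuclideanSpace ℝ (Fin 3)}
    {g : EuclideanSpace ℝ (Fin 3) → EuclideanSpace ℝ (Fin 3)}
    (hthin : ThinObject M q v g) (hdec : HasTypeIDecay A v) :
    ¬ Summit.NavierStokesRegularity.NavierStokesRegularity.Theses.LerayQuarterDissipation.FiniteDissipationLiouville := by
  intro hFDL
  obtain ⟨hv, -, hsing, -⟩ := hthin
  obtain ⟨K', hlaw⟩ := Hardness.exists_dissipationLaw_of_hasTypeIDecay hv hdec
  exact hFDL M K' v hv hlaw fun r hr B => hsing r hr B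

/-- **An enveloped thin object refutes `AsymmetricFlickerLiouville` (24453)** (through the landed
`finiteDissipationLiouville_iff_asymmetricFlickerLiouville`). [folklore] -/
theorem not_asymmetricFlickerLiouville_of_thinObject_of_hasTypeIDecay {M q A : ℝ}
    {v : ℝ → EuclideanSpace ℝ (Fin 3) → EuclideanSpace ℝ (Fin 3)}
    {g : EuclideanSpace ℝ (Fin 3) → EuclideanSpace ℝ (Fin 3)}
    (hthin : ThinObject M q v g) (hdec : HasTypeIDecay A v) :
    ¬ Summit.NavierStokesRegularity.NavierStokesRegularity.Theses.CalmSliceGate.AsymmetricFlickerLiouville :=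
  fun h => not_finiteDissipationLiouville_of_thinObject_of_hasTypeIDecay hthin hdec
    (AsymmetricFlickerLiouville.Negative.finiteDissipationLiouville_iff_asymmetricFlickerLiouville.2 h)

/-! ### 2. The enveloped half of S3 is exactly `FiniteDissipationLiouville` -/

/-- **"No enveloped thin object" ⟺ `FiniteDissipationLiouville`.** Forward: a singular member of a
finite-dissipation stratum yields an enveloped thin object (the critical element of
`exists_thinObject_of_singular_member`, budget `3|B₁|A³`); backward:
`not_finiteDissipationLiouville_of_thinObject_of_hasTypeIDecay`. [folklore] -/
theorem envelopedThinLiouville_iff_finiteDissipationLiouville :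
    (∀ (M q A : ℝ) (v : ℝ → EuclideanSpace ℝ (Fin 3) → EuclideanSpace ℝ (Fin 3))
        (g : EuclideanSpace ℝ (Fin 3) → EuclideanSpace ℝ (Fin 3)),
        ThinObject M q v g → HasTypeIDecay A v → False) ↔
      Summit.NavierStokesRegularity.NavierStokesRegularity.Theses.LerayQuarterDissipation.FiniteDissipationLiouville := by
  constructor
  · intro h
    by_contra hFDL
    unfold Summit.NavierStokesRegularity.NavierStokesRegularity.Theses.LerayQuarterDissipation.FiniteDissipationLiouville at hFDL
    push Not at hFDL
    obtain ⟨C, K, u, hu, hlaw, hsing⟩ := hFDL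
    obtain ⟨-, A, w, g, -, -, -, -, hdec, -, hthin⟩ :=
      exists_thinObject_of_singular_member hu hlaw hsing
    exact h C _ A w g hthin hdec
  · intro hFDL M q A v g hthin hdec
    exact not_finiteDissipationLiouville_of_thinObject_of_hasTypeIDecay hthin hdec hFDL

/-- **"No enveloped thin object" ⟺ `AsymmetricFlickerLiouville` (24453).** [folklore] -/
theorem envelopedThinLiouville_iff_asymmetricFlickerLiouville :
    (∀ (M q A : ℝ) (v : ℝ → EuclideanSpace ℝ (Fin 3) → EuclideanSpace ℝ (Fin 3))
        (g : EuclideanSpace ℝ (Fin 3) → EuclideanSpace ℝ (Fin 3)),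
        ThinObject M q v g → HasTypeIDecay A v → False) ↔
      Summit.NavierStokesRegularity.NavierStokesRegularity.Theses.CalmSliceGate.AsymmetricFlickerLiouville :=
  envelopedThinLiouville_iff_finiteDissipationLiouville.trans
    AsymmetricFlickerLiouville.Negative.finiteDissipationLiouville_iff_asymmetricFlickerLiouville

/-- **"No enveloped thin object" ⟺ `PerpetualFlickerLiouville` (24374).** [folklore] -/
theorem envelopedThinLiouville_iff_perpetualFlickerLiouville :
    (∀ (M q A : ℝ) (v : ℝ → EuclideanSpace ℝ (Fin 3) → EuclideanSpace ℝ (Fin 3))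
        (g : EuclideanSpace ℝ (Fin 3) → EuclideanSpace ℝ (Fin 3)),
        ThinObject M q v g → HasTypeIDecay A v → False) ↔
      Summit.NavierStokesRegularity.NavierStokesRegularity.Theses.CalmSliceGate.PerpetualFlickerLiouville :=
  envelopedThinLiouville_iff_finiteDissipationLiouville.trans
    PerpetualFlickerLiouville.Links.finiteDissipationLiouville_iff_perpetualFlickerLiouville

/-- **"No enveloped thin object" ⟺ the envelope-class Liouville statement** (every enveloped
Type-I ancient mild field is bounded near the apex; `Envelope.finiteDissipationLiouville_iff_envelopeLiouville`):
on the enveloped half, the uniform local energy, the weak trace and the log-thin budget of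
`ThinObject` are redundant. [folklore] -/
theorem envelopedThinLiouville_iff_envelopeLiouville :
    (∀ (M q A : ℝ) (v : ℝ → EuclideanSpace ℝ (Fin 3) → EuclideanSpace ℝ (Fin 3))
        (g : EuclideanSpace ℝ (Fin 3) → EuclideanSpace ℝ (Fin 3)),
        ThinObject M q v g → HasTypeIDecay A v → False) ↔
      ∀ (C A : ℝ) (w : ℝ → EuclideanSpace ℝ (Fin 3) → EuclideanSpace ℝ (Fin 3)),
        IsTypeIAncientMild C w → HasTypeIDecay A w →
        ¬ (∀ r > 0, ∀ M : ℝ, ∃ t ∈ Ioo (-(r ^ 2)) (0 : ℝ),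
          ∃ x ∈ ball (0 : EuclideanSpace ℝ (Fin 3)) r, M < ‖w t x‖) :=
  envelopedThinLiouville_iff_finiteDissipationLiouville.trans
    Envelope.finiteDissipationLiouville_iff_envelopeLiouville

/-! ### 3. S3 = wall ∧ non-enveloped residue -/

/-- **S3 ⟺ `FiniteDissipationLiouville` ∧ "no NON-enveloped thin object".** The registered
signature of `stub_thinCascadeLiouville` (hypothesis / conclusion only — nothing about it is
asserted) splits as the 22144 wall and the residue over thin objects WITHOUT any Type-I envelope.
[folklore] -/
theorem thinCascadeLiouville_iff_finiteDissipationLiouville_and_residue :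
    (∀ (M q : ℝ) (v : ℝ → EuclideanSpace ℝ (Fin 3) → EuclideanSpace ℝ (Fin 3))
        (g : EuclideanSpace ℝ (Fin 3) → EuclideanSpace ℝ (Fin 3)), ¬ ThinObject M q v g) ↔
      Summit.NavierStokesRegularity.NavierStokesRegularity.Theses.LerayQuarterDissipation.FiniteDissipationLiouville ∧
      ∀ (M q : ℝ) (v : ℝ → EuclideanSpace ℝ (Fin 3) → EuclideanSpace ℝ (Fin 3))
        (g : EuclideanSpace ℝ (Fin 3) → EuclideanSpace ℝ (Fin 3)),
        ThinObject M q v g → (∀ A : ℝ, ¬ HasTypeIDecay A v) → False := by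
  constructor
  · intro hS3
    exact ⟨finiteDissipationLiouville_of_thinCascadeLiouville hS3,
      fun M q v g hthin _ => hS3 M q v g hthin⟩
  · rintro ⟨hFDL, hres⟩ M q v g hthin
    by_cases henv : ∃ A : ℝ, HasTypeIDecay A v
    · obtain ⟨A, hA⟩ := henv
      exact not_finiteDissipationLiouville_of_thinObject_of_hasTypeIDecay hthin hA hFDL
    · push Not at henv
      exact hres M q v g hthin henv

/-- **S3 ⟺ `AsymmetricFlickerLiouville` (24453) ∧ "no NON-enveloped thin object".** [folklore] -/
theorem thinCascadeLiouville_iff_asymmetricFlickerLiouville_and_residue :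
    (∀ (M q : ℝ) (v : ℝ → EuclideanSpace ℝ (Fin 3) → EuclideanSpace ℝ (Fin 3))
        (g : EuclideanSpace ℝ (Fin 3) → EuclideanSpace ℝ (Fin 3)), ¬ ThinObject M q v g) ↔
      Summit.NavierStokesRegularity.NavierStokesRegularity.Theses.CalmSliceGate.AsymmetricFlickerLiouville ∧
      ∀ (M q : ℝ) (v : ℝ → EuclideanSpace ℝ (Fin 3) → EuclideanSpace ℝ (Fin 3))
        (g : EuclideanSpace ℝ (Fin 3) → EuclideanSpace ℝ (Fin 3)),
        ThinObject M q v g → (∀ A : ℝ, ¬ HasTypeIDecay A v) → False := by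
  rw [← AsymmetricFlickerLiouville.Negative.finiteDissipationLiouville_iff_asymmetricFlickerLiouville]
  exact thinCascadeLiouville_iff_finiteDissipationLiouville_and_residue

/-- **The residue is all that S3 adds to the wall**: given `FiniteDissipationLiouville`, S3 is
equivalent to "no non-enveloped thin object". [folklore] -/
theorem thinCascadeLiouville_iff_residue_of_finiteDissipationLiouville
    (hFDL : Summit.NavierStokesRegularity.NavierStokesRegularity.Theses.LerayQuarterDissipation.FiniteDissipationLiouville) :
    (∀ (M q : ℝ) (v : ℝ → EuclideanSpace ℝ (Fin 3) → EuclideanSpace ℝ (Fin 3))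
        (g : EuclideanSpace ℝ (Fin 3) → EuclideanSpace ℝ (Fin 3)), ¬ ThinObject M q v g) ↔
      ∀ (M q : ℝ) (v : ℝ → EuclideanSpace ℝ (Fin 3) → EuclideanSpace ℝ (Fin 3))
        (g : EuclideanSpace ℝ (Fin 3) → EuclideanSpace ℝ (Fin 3)),
        ThinObject M q v g → (∀ A : ℝ, ¬ HasTypeIDecay A v) → False := by
  rw [thinCascadeLiouville_iff_finiteDissipationLiouville_and_residue]
  exact ⟨fun h => h.2, fun h => ⟨hFDL, h⟩⟩

end Summit.NavierStokesRegularity.NavierStokesRegularity.Theorems.TypeIQuantSubcubicExp.Negative
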